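import Literature.MathematicalPhysics.QuantumFieldTheory.Balaban1983to89.BlockAveragingExpMeanLog
import Literature.MathematicalPhysics.QuantumFieldTheory.Balaban1983to89.B10Eq47AxialChi
import Literature.MathematicalPhysics.QuantumFieldTheory.Balaban1983to89.LatticeWordStokes
import HarnessLib

/-!
# `Balaban1983to89.BlockAveragingPlaquetteBound` — [Balaban1985Averaging] Prop 1 IN CRUDE FORM FOR THE (0.4) AVERAGING OF
# [Balaban1987RG1] WITH THE PRINTED `exp[mean log]` ON `SU(N)`, PROVED: one averaging step maps `{|U(∂p) − 1| < a ∀p}` into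
# `{|Ū(∂p′) − 1| < (L² + 6((d+2)L)²)·a ∀p′}` as soon as `((d+2)L)²·a/4 < δ_N`

Cell `ym3-torus` (HUMAN RULING D-0037, YM ladder rung R3), seat `ym3-torus-p1` gen 6 (UV side); cell record HOME/UV3-NODE.md §15.  WHY: the
d = 3 route's K1 line needs «averages of small fields are small» for the family's averaging `blockAvg ℰp` ([Balaban1987RG1] (0.4) with the
printed inner operation `exp[|I|⁻¹ Σ log W_i]`, tree `BlockAveragingExpMeanLog.expMeanLogSU`) — the schema `T3LowerAlongMinimisersSplit.Prop1EmlAt`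
(the printed SHARP form of [Balaban1985Averaging] Prop 1 (51), `L²α₀ + C₀(L²α₀)²`, printed for the averaging (15) and asserted for (0.4) by
[Balaban1987RG1] p. 253) and the guard half of cell gap G-K1a-5.  This module PROVES the CRUDE form — linear in `a` with an explicit
constant `C(d, L) = L² + 6((d+2)L)²` — which is all the K1 line uses (its thresholds tend to zero).

THE ARGUMENT.  `Ū(c) = corr(c)·U(c)` (`BlockAveraging.avgFun`): the straight transporter `U(c)` (`AveragingRT.axialAvg`) times the correction
factor `corr(c) = ℰp{U(Γ ∪ [x,x′] ∪ (−Γ′) ∪ (−c))}` on the guard `Small`, `1` off it.  (i) The coarse plaquette of the straight transporters is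
the `L × L` Wilson loop, within `L²·a` of `1` (tree `B10Eq47AxialChi.plaqSmall_axialAvg`, non-abelian Stokes for a square).  (ii) Each loop
variable of (0.4) is within `t := (((d+2)L)²/4)·a` of `1` (tree `LatticeWordStokes.dist1_loopHol_le`, the crude Stokes bound for closed
words), so for `t < δ_N` the guard holds (`LatticeWordStokes.small_of_plaqSmall`) and `corr(c) = exp[mean log]` of elements within `t` of `1`:
by [Balaban1985Averaging] (26) `‖log W‖ ≤ 2‖W − 1‖` (tree `MatrixLog.norm_mlog_le_two_mul`) and (27) `‖e^Z − 1‖ ≤ ‖Z‖e^{‖Z‖}` (tree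
`B7BlockAvgLog.norm_barAvg_sub_one_le`) the correction factor is within `2t·e^{2t} ≤ 6t` of `1` (**`norm_eml_sub_one_le`**, **`dist1_ESU_le`**,
**`dist1_corr_le`**).  (iii) Inserting the four correction factors into the plaquette product costs their four distances
(`|XCY − 1| ≤ |C − 1| + |XY − 1|`, unitary invariance (19)–(20): `dist1_plaquette_with_corr_le`).  Hence
**`dist1_plaqHol_avgFun_le`** / **`plaqSmall_avgFun_expMeanLogSU`**: `PlaqSmall a U ⇒ PlaqSmall ((L² + 6((d+2)L)²)·a) (blockAvg ℰp U)` for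
`0 ≤ a`, `(((d+2)L)²/4)·a < δ_N = min(1/3, π/N)`, standing range `j + 1 ≤ m + K`.

WHAT THIS IS NOT: not the sharp printed (51) (leading coefficient exactly `L²`); not a statement about the divergence clause; `SU(N)` with the
tree's `expMeanLogSU` only (the `U(N)` twin `expMeanLogU` would be identical with `δ = 1/3`).

References: T. Bałaban, CMP 98 (1985) 17–51 [Balaban1985Averaging] ((19)–(20), (26)–(27) pp.21–22, Prop 1 (51) p.26); CMP 109 (1987) 249–301
[Balaban1987RG1] ((0.4) p.253).
-/

noncomputable section

open NormedSpace
open scoped BigOperators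

namespace Literature.MathematicalPhysics.QuantumFieldTheory.Balaban1983to89.BlockAveragingPlaquetteBound

/-! ## §1 The modulus of the printed operation `exp[mean log]` near `1` -/

section Modulus

open ExpMeanLog MatrixLog B7BlockAvgLog

variable {𝔸 : Type*} [NormedRing 𝔸] [NormedAlgebra ℂ 𝔸] [CompleteSpace 𝔸] {ι : Type*} [Fintype ι]

/-- **`‖eml W − 1‖ ≤ 2t·e^{2t}`** if every `‖W_i − 1‖ ≤ t ≤ ½` (nonempty family): (26) `‖log W_i‖ ≤ 2‖W_i − 1‖`, the mean has norm
`≤ 2t`, and (27) `‖e^Z − 1‖ ≤ ‖Z‖e^{‖Z‖}`. [cite: Balaban1985Averaging, (26)-(27) p.22] -/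
theorem norm_eml_sub_one_le [Nonempty ι] {W : ι → 𝔸} {t : ℝ} (hW : ∀ i, ‖W i - 1‖ ≤ t) (ht : t ≤ 1 / 2) :
    ‖eml W - 1‖ ≤ 2 * t * Real.exp (2 * t) := by
  have hc : (0 : ℝ) < Fintype.card ι := Nat.cast_pos.mpr Fintype.card_pos
  have hK : ‖∑ x ∈ Finset.univ, ((Fintype.card ι : ℝ))⁻¹ • ((Complex.I⁻¹ : ℂ) • mlog (W x))‖ ≤ 2 * t := by
    refine (norm_sum_le _ _).trans ?_
    have hterm : ∀ x ∈ (Finset.univ : Finset ι),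
        ‖((Fintype.card ι : ℝ))⁻¹ • ((Complex.I⁻¹ : ℂ) • mlog (W x))‖ ≤ ((Fintype.card ι : ℝ))⁻¹ * (2 * t) := by
      intro x _
      rw [norm_smul, norm_inv, Real.norm_natCast, norm_smul, norm_inv, Complex.norm_I, inv_one, one_mul]
      exact mul_le_mul_of_nonneg_left ((norm_mlog_le_two_mul ((hW x).trans ht)).trans (by linarith [hW x]))
        (inv_nonneg.mpr hc.le)
    refine (Finset.sum_le_sum hterm).trans ?_
    rw [Finset.sum_const, Finset.card_univ, nsmul_eq_mul, ← mul_assoc, mul_inv_cancel₀ hc.ne', one_mul]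
  exact norm_barAvg_sub_one_le Finset.univ (fun _ => ((Fintype.card ι : ℝ))⁻¹) W hK

/-- The same with the cruder constant: `‖eml W − 1‖ ≤ 6t` for `t ≤ ½` (`e^{2t} ≤ e < 3`). [cite: Balaban1985Averaging, (26)-(27) p.22] -/
theorem norm_eml_sub_one_le_six_mul [Nonempty ι] {W : ι → 𝔸} {t : ℝ} (hW : ∀ i, ‖W i - 1‖ ≤ t) (ht : t ≤ 1 / 2) :
    ‖eml W - 1‖ ≤ 6 * t := by
  have h0 : 0 ≤ t := (norm_nonneg _).trans (hW (Classical.arbitrary ι))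
  refine (norm_eml_sub_one_le hW ht).trans ?_
  have hexp : Real.exp (2 * t) ≤ 3 :=
    (Real.exp_le_exp.mpr (by linarith)).trans (le_of_lt (Real.exp_one_lt_d9.trans (by norm_num)))
  nlinarith

end Modulus

/-! ## §2 On `SU(N)`: the guarded operation and the family's `avg` -/

section SUN

open ExpMeanLog
open scoped Matrix.Norms.L2Operator

variable {n : Type*} [Fintype n] [DecidableEq n] [Nonempty n] {ι : Type*} [Fintype ι]

/-- **`dist1 (ESU W) ≤ 6t`** for an `SU(N)`-family with every `dist1 (W i) ≤ t`, `t < δ_N` (so the guard holds and `ESU = exp[mean log]`).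
[cite: Balaban1987RG1, (0.4) p.253] -/
theorem dist1_ESU_le [Nonempty ι] {W : ι → Matrix.specialUnitaryGroup n ℂ} {t : ℝ} (hW : ∀ i, dist1 (W i) ≤ t)
    (ht : t < deltaSU n) : dist1 (ESU W) ≤ 6 * t := by
  have hsmall : ∀ i, ‖(W i : Matrix n n ℂ) - 1‖ < deltaSU n := fun i => (hW i).trans_lt ht
  have ht2 : t ≤ 1 / 2 := (le_of_lt (lt_third_of_lt_deltaSU ht)).trans (by norm_num)
  show ‖((ESU W : Matrix.specialUnitaryGroup n ℂ) : Matrix n n ℂ) - 1‖ ≤ 6 * t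
  rw [coe_ESU_of_small hsmall]
  exact norm_eml_sub_one_le_six_mul (fun i => hW i) ht2

/-- The same for the tree's small-loop average `expMeanLogSU.avg` over any nonempty finite index type (a fixed enumeration of `ESU`).
[cite: Balaban1987RG1, (0.4) and (0.7) p.253] -/
theorem dist1_expMeanLogSU_avg_le [Nonempty ι] {W : ι → Matrix.specialUnitaryGroup n ℂ} {t : ℝ} (hW : ∀ i, dist1 (W i) ≤ t)
    (ht : t < deltaSU n) : dist1 ((expMeanLogSU (n := n)).avg W) ≤ 6 * t := by
  unfold LoopAverage.avg
  exact dist1_ESU_le (fun i => hW _) ht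

end SUN

/-! ## §3 Inserting the correction factors into a plaquette product -/

section Insert

variable {G : Type*} [GaugeGroup G]

/-- `|XCY − 1| ≤ |C − 1| + |XY − 1|` (`XCY = (XCX⁻¹)(XY)`, unitary invariance). [cite: Balaban1985Averaging, (19)-(20) p.21] -/
theorem dist1_insert_le (x c y : G) : dist1 (x * c * y) ≤ dist1 c + dist1 (x * y) := by
  have h : x * c * y = (x * c * x⁻¹) * (x * y) := by group
  rw [h]
  refine (GaugeGroup.dist1_mul_le _ _).trans ?_
  rw [GaugeGroup.dist1_conj]

/-- **THE PLAQUETTE OF CORRECTED TRANSPORTERS**: `|c₁a₁·c₂a₂·(c₃a₃)⁻¹·(c₄a₄)⁻¹ − 1| ≤ |a₁a₂a₃⁻¹a₄⁻¹ − 1| + Σ_i |c_i − 1|`.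
[cite: Balaban1985Averaging, (19)-(20) p.21] -/
theorem dist1_plaquette_with_corr_le (c₁ a₁ c₂ a₂ c₃ a₃ c₄ a₄ : G) :
    dist1 (c₁ * a₁ * (c₂ * a₂) * (c₃ * a₃)⁻¹ * (c₄ * a₄)⁻¹) ≤
      dist1 (a₁ * a₂ * a₃⁻¹ * a₄⁻¹) + (dist1 c₁ + dist1 c₂ + dist1 c₃ + dist1 c₄) := by
  have e₁ : c₁ * a₁ * (c₂ * a₂) * (c₃ * a₃)⁻¹ * (c₄ * a₄)⁻¹ = 1 * c₁ * (a₁ * c₂ * a₂ * a₃⁻¹ * c₃⁻¹ * a₄⁻¹ * c₄⁻¹) := by group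
  have e₂ : 1 * (a₁ * c₂ * a₂ * a₃⁻¹ * c₃⁻¹ * a₄⁻¹ * c₄⁻¹) = a₁ * c₂ * (a₂ * a₃⁻¹ * c₃⁻¹ * a₄⁻¹ * c₄⁻¹) := by group
  have e₃ : a₁ * (a₂ * a₃⁻¹ * c₃⁻¹ * a₄⁻¹ * c₄⁻¹) = (a₁ * a₂ * a₃⁻¹) * c₃⁻¹ * (a₄⁻¹ * c₄⁻¹) := by group
  have e₄ : a₁ * a₂ * a₃⁻¹ * (a₄⁻¹ * c₄⁻¹) = (a₁ * a₂ * a₃⁻¹ * a₄⁻¹) * c₄⁻¹ * 1 := by group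
  calc dist1 (c₁ * a₁ * (c₂ * a₂) * (c₃ * a₃)⁻¹ * (c₄ * a₄)⁻¹)
      = dist1 (1 * c₁ * (a₁ * c₂ * a₂ * a₃⁻¹ * c₃⁻¹ * a₄⁻¹ * c₄⁻¹)) := by rw [e₁]
    _ ≤ dist1 c₁ + dist1 (1 * (a₁ * c₂ * a₂ * a₃⁻¹ * c₃⁻¹ * a₄⁻¹ * c₄⁻¹)) := dist1_insert_le _ _ _
    _ = dist1 c₁ + dist1 (a₁ * c₂ * (a₂ * a₃⁻¹ * c₃⁻¹ * a₄⁻¹ * c₄⁻¹)) := by rw [e₂]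
    _ ≤ dist1 c₁ + (dist1 c₂ + dist1 (a₁ * (a₂ * a₃⁻¹ * c₃⁻¹ * a₄⁻¹ * c₄⁻¹))) := by
        refine add_le_add le_rfl (dist1_insert_le _ _ _)
    _ = dist1 c₁ + (dist1 c₂ + dist1 ((a₁ * a₂ * a₃⁻¹) * c₃⁻¹ * (a₄⁻¹ * c₄⁻¹))) := by rw [e₃]
    _ ≤ dist1 c₁ + (dist1 c₂ + (dist1 c₃⁻¹ + dist1 ((a₁ * a₂ * a₃⁻¹) * (a₄⁻¹ * c₄⁻¹)))) := by
        refine add_le_add le_rfl (add_le_add le_rfl (dist1_insert_le _ _ _))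
    _ = dist1 c₁ + (dist1 c₂ + (dist1 c₃ + dist1 ((a₁ * a₂ * a₃⁻¹ * a₄⁻¹) * c₄⁻¹ * 1))) := by
        rw [GaugeGroup.dist1_inv, e₄]
    _ ≤ dist1 c₁ + (dist1 c₂ + (dist1 c₃ + (dist1 c₄⁻¹ + dist1 ((a₁ * a₂ * a₃⁻¹ * a₄⁻¹) * 1)))) := by
        refine add_le_add le_rfl (add_le_add le_rfl (add_le_add le_rfl (dist1_insert_le _ _ _)))
    _ = dist1 (a₁ * a₂ * a₃⁻¹ * a₄⁻¹) + (dist1 c₁ + dist1 c₂ + dist1 c₃ + dist1 c₄) := by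
        rw [GaugeGroup.dist1_inv, mul_one]; ring

end Insert

/-! ## §4 The correction factors of (0.4) on small fields, and the coarse plaquettes -/

section Main

open BlockAveraging ExpMeanLog LatticeWordStokes T4Continuum
open scoped Matrix.Norms.L2Operator

variable {n : Type*} [Fintype n] [DecidableEq n] [Nonempty n] {P : Params} {j : ℕ}

/-- **THE CORRECTION FACTOR IS CLOSE TO `1` ON SMALL FIELDS**: if every plaquette variable of the `SU(N)` configuration `U` is within
`a ≥ 0` of `1` and `t := (((d+2)L)²/4)·a < δ_N`, then at every coarse bond `dist1 (corr ℰp U c) ≤ 6t` — the guard holds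
(`small_of_plaqSmall`), every (0.4) loop variable is within `t` of `1` (`dist1_loopHol_le`), and §2. [cite: Balaban1987RG1, (0.4) p.253] -/
theorem dist1_corr_le {a : ℝ} (ha : 0 ≤ a) {U : GaugeField P j (Matrix.specialUnitaryGroup n ℂ)} (hU : PlaqSmall a U)
    (ht : ((((P.d + 2) * P.L : ℕ) : ℝ) ^ 2 / 4) * a < deltaSU n) (c : PBond P (j + 1)) :
    dist1 (corr (expMeanLogSU (n := n)) U c) ≤ 6 * (((((P.d + 2) * P.L : ℕ) : ℝ) ^ 2 / 4) * a) := by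
  have hsmall : Small (expMeanLogSU (n := n)) U c := small_of_plaqSmall _ ha hU ht c
  unfold corr
  rw [if_pos hsmall]
  exact dist1_expMeanLogSU_avg_le (fun i => dist1_loopHol_le ha hU c i) ht

/-- **THE COARSE PLAQUETTES OF THE (0.4)-AVERAGED FIELD**: under `PlaqSmall a U` (`a ≥ 0`), `(((d+2)L)²/4)·a < δ_N`, standing range
`j + 1 ≤ m + K`: every plaquette variable of `Ū = avgFun ℰp U` satisfies `dist1 < (L² + 6((d+2)L)²)·a` — the straight transporters' square
Wilson loop (`< L²a`, `B10Eq47AxialChi.plaqSmall_axialAvg`) plus four correction factors (`≤ 6t` each, §3).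
[cite: Balaban1985Averaging, Prop. 1 (51) p.26; Balaban1987RG1, (0.4) p.253] -/
theorem dist1_plaqHol_avgFun_lt (hj : j + 1 ≤ P.m + P.K) {a : ℝ} (ha : 0 ≤ a) {U : GaugeField P j (Matrix.specialUnitaryGroup n ℂ)}
    (hU : PlaqSmall a U) (ht : ((((P.d + 2) * P.L : ℕ) : ℝ) ^ 2 / 4) * a < deltaSU n) (p : Plaq P (j + 1)) :
    dist1 (GaugeField.plaqHol (avgFun (expMeanLogSU (n := n)) U) p) <
      ((P.L : ℝ) ^ 2 + 6 * (((P.d + 2) * P.L : ℕ) : ℝ) ^ 2) * a := by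
  have hax := B10Eq47AxialChi.plaqSmall_axialAvg hj hU p
  have hc := fun c => dist1_corr_le (n := n) ha hU ht c
  have hins := dist1_plaquette_with_corr_le
    (corr (expMeanLogSU (n := n)) U ⟨p.src, p.μ⟩) (AveragingRT.axialAvg U ⟨p.src, p.μ⟩)
    (corr (expMeanLogSU (n := n)) U ⟨p.src.shift p.μ, p.ν⟩) (AveragingRT.axialAvg U ⟨p.src.shift p.μ, p.ν⟩)
    (corr (expMeanLogSU (n := n)) U ⟨p.src.shift p.ν, p.μ⟩) (AveragingRT.axialAvg U ⟨p.src.shift p.ν, p.μ⟩)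
    (corr (expMeanLogSU (n := n)) U ⟨p.src, p.ν⟩) (AveragingRT.axialAvg U ⟨p.src, p.ν⟩)
  have h1 := hc ⟨p.src, p.μ⟩
  have h2 := hc ⟨p.src.shift p.μ, p.ν⟩
  have h3 := hc ⟨p.src.shift p.ν, p.μ⟩
  have h4 := hc ⟨p.src, p.ν⟩
  have hax' : dist1 (AveragingRT.axialAvg U ⟨p.src, p.μ⟩ * AveragingRT.axialAvg U ⟨p.src.shift p.μ, p.ν⟩ *
      (AveragingRT.axialAvg U ⟨p.src.shift p.ν, p.μ⟩)⁻¹ * (AveragingRT.axialAvg U ⟨p.src, p.ν⟩)⁻¹) < (P.L : ℝ) ^ 2 * a := hax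
  show dist1 (corr _ U ⟨p.src, p.μ⟩ * AveragingRT.axialAvg U ⟨p.src, p.μ⟩ *
      (corr _ U ⟨p.src.shift p.μ, p.ν⟩ * AveragingRT.axialAvg U ⟨p.src.shift p.μ, p.ν⟩) *
      (corr _ U ⟨p.src.shift p.ν, p.μ⟩ * AveragingRT.axialAvg U ⟨p.src.shift p.ν, p.μ⟩)⁻¹ *
      (corr _ U ⟨p.src, p.ν⟩ * AveragingRT.axialAvg U ⟨p.src, p.ν⟩)⁻¹) < _
  nlinarith

/-- **[Balaban1985Averaging] PROP 1, CRUDE FORM, FOR THE (0.4) AVERAGING WITH `exp[mean log]` ON `SU(N)` — PROVED**: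
`PlaqSmall a U ⇒ PlaqSmall ((L² + 6((d+2)L)²)·a) (blockAvg ℰp U)` (`0 ≤ a`, `(((d+2)L)²/4)·a < δ_N`, standing range).
[cite: Balaban1985Averaging, Prop. 1 (51) p.26; Balaban1987RG1, (0.4) p.253] -/
theorem plaqSmall_blockAvg_expMeanLogSU (hj : j + 1 ≤ P.m + P.K) {a : ℝ} (ha : 0 ≤ a)
    {U : GaugeField P j (Matrix.specialUnitaryGroup n ℂ)} (hU : PlaqSmall a U)
    (ht : ((((P.d + 2) * P.L : ℕ) : ℝ) ^ 2 / 4) * a < deltaSU n) :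
    PlaqSmall (((P.L : ℝ) ^ 2 + 6 * (((P.d + 2) * P.L : ℕ) : ℝ) ^ 2) * a) ((blockAvg (expMeanLogSU (n := n))).avg U) :=
  fun p => dist1_plaqHol_avgFun_lt hj ha hU ht p

end Main

end Literature.MathematicalPhysics.QuantumFieldTheory.Balaban1983to89.BlockAveragingPlaquetteBound

end
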